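import Mathlib.RingTheory.Localization.Integer
import Summits.ABC.IUTFork.Joshi.ArithHolStructureTiltRoots
import HarnessLib

/-!
# `IsAlgClosed (K♭)`: the tilt of an (algebraically closed) untilt is ALGEBRAICALLY CLOSED — the last Def. 4.1.1 slot at `F := K♭`
# (MODEL / SUPPLY over p442777/p446090/p447287; part 2 of 2, over `ArithHolStructureTiltRoots.lean`)

Block E (rung LADDER-ABC:A2.E), seat abc-iut-E-t10 (gen 4). [J-I] = Joshi, arXiv:2106.11452v4: §3.3 p.9 l.31–33 «one has naturally associated
field K♭, **algebraically closed**, perfectoid of characteristic p > 0, called the tilt of K» (citing [Scholze 2012, Lem. 3.4]; the algebraic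
closedness follows from [Scholze 2012, Thm. 3.7 (ii)] — the degree-preserving tilting equivalence of finite extensions; Prop. 3.8 there is
the CONVERSE «K♭ alg. closed ⟹ K alg. closed»); Def. 4.1.1 (1) p.18 l.11ff types the tilt base `F` with `[IsAlgClosed F]`. p431050's reading note (f)
recorded that NON-VACUITY of `ArithHolStructure X A F` was not constructible; p447287 reduced it to this one slot. PROVED HERE, hypothesis-free,
for every untilt `K` (E-t1's `Untilt p`: algebraically closed, complete, `‖p‖ < 1`), by the elementary LIMIT-FREE argument of the blueprint
`HOME/staging/E/t10/PLAN-IsAlgClosedTilt.md` (no almost-mathematics / tilting equivalence is used):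
* `exists_root_sequence`: roots `β_0, β_1, …` of the level polynomials with `‖β_n − β_{n+1}^p‖^{p·d} ≤ ‖p‖` (sequential choice by
  `exists_root_succ`); `telescope`: `‖β_{j+k}^{p^k} − β_j‖^{p·d} ≤ ‖p‖`;
* **`exists_root_int`**: every monic `Y^d + Σ a_i Y^i` over `𝒪_{K♭} = (𝒪_K/p)^perf` (`d ≥ 1`) HAS A ROOT `r ∈ 𝒪_{K♭}` — namely
  `r := (β_{m+j}^{p^m} mod p)_j` with `m = p·d` (Frobenius-compatible by the decay lemma), and `P(r) = 0` because
  `|P(r)|_♭^{p·d} = (‖T(Φ^{-j} P(r))‖^{p·d})^{p^j} ≤ ‖p‖^{j}` for every `j` (Teichmüller representative ≡ `levelPoly j (β_{m+j}^{p^m})` mod `p`,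
  which is `‖·‖^{pd} ≤ ‖p‖`-small by telescoping + Lipschitz);
* **`isAlgClosed_Fr` / `isAlgClosed_tilt U : IsAlgClosed (ATS1.tilt U)`** (clear denominators with `IsLocalization.exist_integer_multiples`,
  `IsAlgClosed.of_exists_root`);
* `tilt_slots_all`: ALL FIVE classes Def. 4.1.1 (1) puts on the tilt base hold at `F := K♭` (with p442777 `normedFieldTilt`, p447287
  `completeSpace_tilt`, p446090 `isUltrametricDist_tilt`, p431050 `charP_tilt`).
All [folklore] ([Scholze 2012, Thm. 3.7 (ii)]; here by an elementary route); no claim of Joshi's used or asserted; no `Prop` hypothesis, instance,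
notation or FACT-LIST row. Typed ≠ proved ≠ endorsed; no side taken on [IUTchIII] Cor. 3.12 or on any author. bears_on: LADDER-ABC:A2.E.

REVISION r1 (docstring-only on the r0 declarations, which are byte-identical below the docstrings; + APPENDED §«ℂ_p♭»): audit LOW-1 of
abc-iut-E-t25 g5 (15:31:39Z) / referee E-ref-3 VERDICT 38 (16:54:40Z) — the r0 text cited «[Scholze 2012, Prop. 3.8]» for `K` alg. closed ⟹
`K♭` alg. closed; Prop. 3.8 (arXiv:1111.4914 p.13) is the CONVERSE, and the direction proved here is the corollary of Thm. 3.7 (ii) (tilting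
equivalence of finite extensions, degree-preserving). Citations re-addressed; kernel content unchanged. APPENDED: `BerkovichDatum.trivial` and
`ArithHolStructure.ofPadicComplexTilt` — Def. 4.1.1's structure INHABITED OUTRIGHT for every tempered curve `X` at the trivial Berkovich datum
and the tilt base `F := ℂ_p♭ = ATS1.tilt (Untilt.padicComplex p)` (E-t1's `Untilt.padicComplex`, `ATSObj.embPadicComplex`), closing p431050
reading note (f) with a closed term.
-/

noncomputable section

open scoped NNReal
open Polynomial

namespace Summit.ABC.IUTFork.Joshi.ATS1

open Summit.ABC.IUTFork.Joshi

variable {p : ℕ} [Fact p.Prime]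

namespace TiltModel

section Integral

variable (U : Untilt p) [Fact (¬ IsUnit ((p : ℕ) : int U))] [IsAdicComplete (Ideal.span {((p : ℕ) : int U)}) (int U)]
  {d : ℕ} (a : Fin d → PreTilt (int U) p)

/-- **A coherent sequence of level roots**: `β_n ∈ 𝒪_K` with `levelPoly n (β_n) = 0` and `‖β_n − β_{n+1}^p‖^{p·d} ≤ ‖p‖` (dependent choice
along `exists_root_succ`). [folklore] -/
theorem exists_root_sequence (hd : 0 < d) :
    ∃ b : ℕ → int U, (∀ n, (levelPoly U a n).eval (b n) = 0) ∧
      ∀ n, ‖(b n : U.K) - (b (n + 1) : U.K) ^ p‖ ^ (p * d) ≤ ‖(p : U.K)‖ := by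
  have h0 := exists_root_levelPoly U a hd 0
  let β : (n : ℕ) → {β : int U // (levelPoly U a n).eval β = 0} := fun n =>
    Nat.rec (motive := fun n => {β : int U // (levelPoly U a n).eval β = 0}) ⟨h0.choose, h0.choose_spec⟩
      (fun n c => ⟨(exists_root_succ U a hd n c.1 c.2).choose, (exists_root_succ U a hd n c.1 c.2).choose_spec.1⟩) n
  exact ⟨fun n => (β n).1, fun n => (β n).2, fun n => (exists_root_succ U a hd n (β n).1 (β n).2).choose_spec.2⟩

omit [Fact (¬ IsUnit ((p : ℕ) : int U))] [IsAdicComplete (Ideal.span {((p : ℕ) : int U)}) (int U)] in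
/-- **Telescoping**: `‖β_{j+k}^{p^k} − β_j‖^{p·d} ≤ ‖p‖` along such a sequence (`‖x^N − y^N‖ ≤ ‖x − y‖`, ultrametric). [folklore] -/
theorem telescope (b : ℕ → int U) (hb : ∀ n, ‖(b n : U.K) - (b (n + 1) : U.K) ^ p‖ ^ (p * d) ≤ ‖(p : U.K)‖)
    (hpd : 0 < p * d) (j k : ℕ) : ‖(b (j + k) : U.K) ^ p ^ k - (b j : U.K)‖ ^ (p * d) ≤ ‖(p : U.K)‖ := by
  induction k with
  | zero => simp [zero_pow hpd.ne']
  | succ k ih =>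
    have hsplit : (b (j + (k + 1)) : U.K) ^ p ^ (k + 1) - (b j : U.K) =
        (((b (j + k + 1) : U.K) ^ p) ^ p ^ k - (b (j + k) : U.K) ^ p ^ k) + ((b (j + k) : U.K) ^ p ^ k - b j) := by
      rw [pow_succ', pow_mul, ← add_assoc]; ring
    rw [hsplit]
    refine pow_norm_add_le ?_ ih
    have h1 := norm_pow_sub_pow_le (b (j + k + 1) ^ p) (b (j + k)) (p ^ k)
    push_cast at h1
    refine pow_norm_le_of_norm_le h1 ?_
    rw [norm_sub_rev]
    exact hb (j + k)

/-- **Every monic polynomial over `𝒪_{K♭}` of positive degree has a root in `𝒪_{K♭}`** — the core of `IsAlgClosed (K♭)`: with level roots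
`β_n` (`exists_root_sequence`) and `m := p·d`, the residues `β_{m+j}^{p^m} mod p` form an element `r ∈ (𝒪_K/p)^perf` (decay lemma), and
`|P(r)|_♭^{p·d} ≤ ‖p‖^j` for every `j` (Teichmüller representative of `Φ^{-j} P(r)` ≡ `levelPoly j (β_{m+j}^{p^m})` mod `p`, which is small by
telescoping + Lipschitz), whence `P(r) = 0`. PROVED. [folklore] -/
theorem exists_root_int (hd : 0 < d) : ∃ r : PreTilt (int U) p, r ^ d + ∑ i : Fin d, a i * r ^ (i : ℕ) = 0 := by
  have hp : p.Prime := Fact.out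
  have hp0 : 0 < ‖(p : U.K)‖ := norm_pos_iff.2 (natCast_p_ne_zero U)
  have hp1 : ‖(p : U.K)‖ < 1 := U.norm_p_lt_one
  have hpd : 0 < p * d := Nat.mul_pos hp.pos hd
  obtain ⟨b, hb, hcl⟩ := exists_root_sequence U a hd
  -- the candidate root: residues of `β_{pd+j}^{p^{pd}}`, Frobenius-compatible by the decay lemma
  have hcompat : ∀ j, (Ideal.Quotient.mk (Ideal.span {((p : ℕ) : int U)}) (b (p * d + (j + 1)) ^ p ^ (p * d))) ^ p =
      Ideal.Quotient.mk (Ideal.span {((p : ℕ) : int U)}) (b (p * d + j) ^ p ^ (p * d)) := by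
    intro j
    rw [← map_pow, ← pow_mul, ← pow_succ, pow_succ', pow_mul]
    refine Ideal.Quotient.eq.2 (pow_sub_pow_mem_span_p _ _ ?_)
    rw [norm_sub_rev]; push_cast
    exact hcl (p * d + j)
  let r : PreTilt (int U) p :=
    ⟨fun j => Ideal.Quotient.mk (Ideal.span {((p : ℕ) : int U)}) (b (p * d + j) ^ p ^ (p * d)), fun j => hcompat j⟩
  have hcr : ∀ j, PreTilt.coeff j r = Ideal.Quotient.mk (Ideal.span {((p : ℕ) : int U)}) (b (p * d + j) ^ p ^ (p * d)) :=
    fun j => rfl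
  refine ⟨r, ?_⟩
  set y := r ^ d + ∑ i : Fin d, a i * r ^ (i : ℕ) with hy
  -- level `j`: `‖levelPoly j (β_{m+j}^{p^m})‖^{pd} ≤ ‖p‖` (telescoping + Lipschitz, `levelPoly j (β_j) = 0`)
  have hE : ∀ j, ‖(((levelPoly U a j).eval (b (p * d + j) ^ p ^ (p * d)) : int U) : U.K)‖ ^ (p * d) ≤ ‖(p : U.K)‖ := by
    intro j
    obtain ⟨w, hw⟩ := Polynomial.sub_dvd_eval_sub (b (p * d + j) ^ p ^ (p * d)) (b j) (levelPoly U a j)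
    rw [hb j, sub_zero] at hw
    rw [hw]; push_cast
    refine pow_norm_le_of_norm_le (z := ((b (p * d + j) : U.K) ^ p ^ (p * d) - (b j : U.K)))
      (by rw [norm_mul]; exact mul_le_of_le_one_right (norm_nonneg _) (norm_coe_le_one w)) ?_
    have := telescope U (d := d) b hcl hpd j (p * d)
    rwa [Nat.add_comm j (p * d)] at this
  -- coefficient `j` of `y` is `levelPoly j (β_{m+j}^{p^m}) mod p`
  have hcoeff : ∀ j, PreTilt.coeff j y =
      Ideal.Quotient.mk (Ideal.span {((p : ℕ) : int U)}) ((levelPoly U a j).eval (b (p * d + j) ^ p ^ (p * d))) := by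
    intro j
    simp only [hy, map_add, map_pow, map_sum, map_mul, hcr, coeff_eq_mk_towerInt, levelPoly_eval]
  -- valuation estimate at every level
  have hval : ∀ j, (valInt U y : ℝ) ^ (p * d) ≤ ‖(p : U.K)‖ ^ j := by
    intro j
    set g := (frobeniusEquiv (PreTilt (int U) p) p).symm^[j] y with hg
    have hgy : g ^ p ^ j = y := iterate_frobeniusEquiv_symm_pow_p_pow (PreTilt (int U) p) p y j
    have hTmod : Ideal.Quotient.mk (Ideal.span {((p : ℕ) : int U)}) (Perfection.teichmuller₀ p (Ideal.span {((p : ℕ) : int U)}) g) =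
        Ideal.Quotient.mk (Ideal.span {((p : ℕ) : int U)}) ((levelPoly U a j).eval (b (p * d + j) ^ p ^ (p * d))) := by
      rw [Perfection.mk_teichmuller₀, ← PreTilt.coeff_def, hg, PreTilt.coeff_iterate_frobeniusEquiv_symm, zero_add, hcoeff j]
    have hTsmall : ‖((Perfection.teichmuller₀ p (Ideal.span {((p : ℕ) : int U)}) g : int U) : U.K)‖ ^ (p * d) ≤ ‖(p : U.K)‖ := by
      have h1 := (mem_span_p_iff U).1 (Ideal.Quotient.eq.1 hTmod)
      push_cast at h1
      have h2 := (pow_le_pow_left₀ (norm_nonneg _) h1 (p * d)).trans (pow_le_of_le_one hp0.le hp1.le hpd.ne')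
      have h3 := pow_norm_add_le h2 (hE j)
      rwa [sub_add_cancel] at h3
    have hvy : (valInt U y : ℝ) = ‖((Perfection.teichmuller₀ p (Ideal.span {((p : ℕ) : int U)}) g : int U) : U.K)‖ ^ p ^ j := by
      rw [← hgy, map_pow, NNReal.coe_pow, valInt_eq_nnnorm, flatInt_apply_zero, coe_nnnorm]
    rw [hvy, ← pow_mul, mul_comm (p ^ j) (p * d), pow_mul]
    calc (‖((Perfection.teichmuller₀ p (Ideal.span {((p : ℕ) : int U)}) g : int U) : U.K)‖ ^ (p * d)) ^ p ^ j
        ≤ ‖(p : U.K)‖ ^ p ^ j := pow_le_pow_left₀ (by positivity) hTsmall _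
      _ ≤ ‖(p : U.K)‖ ^ j := pow_le_pow_of_le_one hp0.le hp1.le (Nat.lt_pow_self hp.one_lt).le
  -- conclude `y = 0`
  by_contra hy0
  have hv0 : 0 < (valInt U y : ℝ) ^ (p * d) := by
    have h : valInt U y ≠ 0 := valInt_ne_zero U hy0
    have h' : (0 : ℝ) < valInt U y := by exact_mod_cast pos_iff_ne_zero.2 h
    exact pow_pos h' _
  obtain ⟨j, hj⟩ := exists_pow_lt_of_lt_one hv0 hp1
  exact (not_lt.2 (hval j)) hj

end Integral

/-! ## `K♭` is algebraically closed -/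

section Frac

variable (U : Untilt p) [Fact (¬ IsUnit ((p : ℕ) : int U))] [IsDomain (PreTilt (int U) p)]
  [IsAdicComplete (Ideal.span {((p : ℕ) : int U)}) (int U)]

/-- **`K♭ = Frac (𝒪_K/p)^perf` IS ALGEBRAICALLY CLOSED** for every untilt `K` ([Scholze 2012, Thm. 3.7 (ii)] corollary; [J-I] §3.3): a monic `Q ∈ K♭[X]`
of degree `d ≥ 1` becomes, after clearing denominators (`Y = c·X`, `IsLocalization.exist_integer_multiples`), a monic polynomial over
`𝒪_{K♭}`, which has a root by `exists_root_int`. PROVED. [folklore] -/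
theorem isAlgClosed_Fr : IsAlgClosed (tiltFr U) := by
  refine IsAlgClosed.of_exists_root _ fun Q hQm hQi => ?_
  set d := Q.natDegree with hd
  have hd0 : 0 < d := by
    refine Nat.pos_of_ne_zero fun h => hQi.not_isUnit ?_
    rw [Polynomial.eq_one_of_monic_natDegree_zero hQm h]; exact isUnit_one
  -- clear denominators: `c ∈ 𝒪_{K♭}⁰`, `a'_i ∈ 𝒪_{K♭}` with `a'_i = c · Q_i`
  obtain ⟨c, hc⟩ := IsLocalization.exist_integer_multiples (nonZeroDivisors (PreTilt (int U) p)) (Finset.univ : Finset (Fin d))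
    (fun i => Q.coeff i)
  have hc' : ∀ i : Fin d, ∃ x : PreTilt (int U) p, algebraMap _ (tiltFr U) x = (c : PreTilt (int U) p) • Q.coeff (i : ℕ) :=
    fun i => hc i (Finset.mem_univ i)
  choose a' ha' using hc'
  set C : tiltFr U := algebraMap (PreTilt (int U) p) (tiltFr U) c with hCdef
  have hC0 : C ≠ 0 := IsFractionRing.to_map_ne_zero_of_mem_nonZeroDivisors c.2
  have hsmul : ∀ i : Fin d, C * Q.coeff i = algebraMap _ (tiltFr U) (a' i) := fun i => by
    rw [ha' i, Algebra.smul_def]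
  -- a root `r` of the integral monic polynomial `Y^d + Σ (c^{d-1-i} a'_i) Y^i`
  obtain ⟨r, hr⟩ := exists_root_int U (fun i : Fin d => (c : PreTilt (int U) p) ^ (d - 1 - (i : ℕ)) * a' i) hd0
  set R : tiltFr U := algebraMap (PreTilt (int U) p) (tiltFr U) r with hRdef
  refine ⟨R / C, ?_⟩
  have hQm' : Q.coeff d = 1 := Polynomial.Monic.coeff_natDegree hQm
  have hterm : ∀ i : Fin d, C ^ d * (Q.coeff i * (R / C) ^ (i : ℕ)) =
      algebraMap _ (tiltFr U) (((c : PreTilt (int U) p) ^ (d - 1 - (i : ℕ)) * a' i) * r ^ (i : ℕ)) := by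
    intro i
    have hi : (i : ℕ) < d := i.2
    have hCd : C ^ d = C ^ (d - 1 - (i : ℕ)) * C * C ^ (i : ℕ) := by
      rw [← pow_succ, ← pow_add]; congr 1; omega
    rw [map_mul, map_mul, map_pow, map_pow, ← hsmul i, ← hRdef, ← hCdef, hCd, div_pow]
    field_simp
  -- `C^d · Q(R/C) = algebraMap (r^d + Σ a_i r^i) = 0`
  have hkey : C ^ d * Q.eval (R / C) =
      algebraMap _ (tiltFr U) (r ^ d + ∑ i : Fin d, ((c : PreTilt (int U) p) ^ (d - 1 - (i : ℕ)) * a' i) * r ^ (i : ℕ)) := by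
    rw [eval_eq_sum_range, ← hd, Finset.sum_range_succ, Finset.sum_range, hQm', one_mul, mul_add, Finset.mul_sum, map_add, map_pow,
      map_sum, ← hRdef, add_comm]
    congr 1
    · rw [div_pow, ← mul_div_assoc, mul_div_cancel_left₀ _ (pow_ne_zero d hC0)]
    · exact Finset.sum_congr rfl fun i _ => hterm i
  have h0 : C ^ d * Q.eval (R / C) = 0 := by
    rw [hkey, hr, map_zero]
  exact (mul_eq_zero.1 h0).resolve_left (pow_ne_zero d hC0)

end Frac

/-! ## On `ATS1.tilt U`: algebraically closed; all five tilt-base slots of Def. 4.1.1; NON-VACUITY -/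

/-- **`IsAlgClosed (ATS1.tilt U)`** — the tilt of every untilt is algebraically closed; explicit, hypothesis-free ([J-I] §3.3 «K♭, algebraically
closed»; [Scholze 2012, Thm. 3.7 (ii)] corollary — Prop. 3.8 there is the converse). PROVED. [folklore] -/
theorem isAlgClosed_tilt (U : Untilt p) : IsAlgClosed (tilt U) :=
  haveI : Fact (¬ IsUnit ((p : ℕ) : int U)) := ⟨not_isUnit_p U⟩
  haveI : IsDomain (PreTilt (int U) p) := isDomain_preTilt U
  haveI : IsAdicComplete (Ideal.span {((p : ℕ) : int U)}) (int U) := isAdicComplete_int U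
  isAlgClosed_Fr U

/-- The same, for the field structure underlying the NORMED field `(ATS1.tilt U, normedFieldTilt U)` (the instance path Def. 4.1.1's
`[NormedField F] … [IsAlgClosed F]` uses). [folklore] -/
theorem isAlgClosed_normedFieldTilt (U : Untilt p) :
    @IsAlgClosed (tilt U) (@NormedField.toField (tilt U) (normedFieldTilt U)) := isAlgClosed_tilt U

/-- `CharP (ATS1.tilt U) p` along the same instance path (p431050 `charP_tilt`). [folklore] -/
theorem charP_normedFieldTilt (U : Untilt p) :
    @CharP (tilt U) (@AddGroupWithOne.toAddMonoidWithOne (tilt U) (@Ring.toAddGroupWithOne (tilt U) (@DivisionRing.toRing (tilt U)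
      (@Field.toDivisionRing (tilt U) (@NormedField.toField (tilt U) (normedFieldTilt U)))))) p := charP_tilt U

/-- **All five classes Def. 4.1.1 (1) puts on the tilt base `F`, at `F := K♭ = ATS1.tilt U`**: `NormedField` (p442777 `normedFieldTilt`, the
instance under which the rest is stated), `CompleteSpace` (p447287), `IsUltrametricDist` (p446090), `IsAlgClosed` (above), `CharP _ p` (p431050).
[folklore] -/
theorem tilt_slots_all (U : Untilt p) :
    letI := normedFieldTilt U
    CompleteSpace (tilt U) ∧ IsUltrametricDist (tilt U) ∧ IsAlgClosed (tilt U) ∧ CharP (tilt U) p :=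
  ⟨completeSpace_tilt U, isUltrametricDist_tilt U, isAlgClosed_normedFieldTilt U, charP_normedFieldTilt U⟩

end TiltModel

namespace ArithHolStructure

open TiltModel

variable {X : Literature.AnabelianGeometry.SemiGraphs.TemperedCurve p} {A : BerkovichDatum X}

/-- **NON-VACUITY of [J-I] Def. 4.1.1 AT THE GENUINE TILT** (p431050 reading note (f) discharged): for every untilt `K` receiving `E = X.K`
and every base point `∗_K`, the arithmetic holomorphic structure `(X/E, (K ⊃ E, K♭ ≃ K♭), ∗_K)` over the tilt base `F := K♭ = ATS1.tilt U`
ITSELF — all five instance slots supplied by the hypothesis-free terms above, tilting datum `ι = id`, `♯` from the constructed tilt-monoid datum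
(p442777 `tiltMonoidDatum`). CONSTRUCTED. [claim: Joshi2021ATS1, status: disputed] -/
def ofTilt (U : Untilt p) (emb : X.K →+* U.K) (h : Continuous fun x : ℚ_[p] => emb (algebraMap ℚ_[p] X.K x)) (b : A.BasePt U emb) :
    letI := normedFieldTilt U
    haveI := completeSpace_tilt U
    haveI := isUltrametricDist_tilt U
    haveI := isAlgClosed_normedFieldTilt U
    haveI := charP_normedFieldTilt U
    ArithHolStructure X A (tilt U) :=
  letI := normedFieldTilt U
  haveI := completeSpace_tilt U
  haveI := isUltrametricDist_tilt U
  haveI := isAlgClosed_normedFieldTilt U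
  haveI := charP_normedFieldTilt U
  ofTiltMonoidDatum U emb h (RingEquiv.refl _) (tiltMonoidDatum U) b

/-- … its untilt is `K` itself. [folklore] -/
theorem ofTilt_U (U : Untilt p) (emb : X.K →+* U.K) (h : Continuous fun x : ℚ_[p] => emb (algebraMap ℚ_[p] X.K x)) (b : A.BasePt U emb) :
    letI := normedFieldTilt U
    haveI := completeSpace_tilt U
    haveI := isUltrametricDist_tilt U
    haveI := isAlgClosed_normedFieldTilt U
    haveI := charP_normedFieldTilt U
    (ofTilt U emb h b).U = U := rfl

/-- … and it satisfies BOTH Prop. 4.1.7 (1) clauses typed concretely in p431050 — «same value groups» (p433682) and «same residue fields»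
(p446090) — OUTRIGHT. [claim: Joshi2021ATS1, status: disputed] -/
theorem ofTilt_sameValueGroup_sameResidueField (U : Untilt p) (emb : X.K →+* U.K)
    (h : Continuous fun x : ℚ_[p] => emb (algebraMap ℚ_[p] X.K x)) (b : A.BasePt U emb) :
    letI := normedFieldTilt U
    haveI := completeSpace_tilt U
    haveI := isUltrametricDist_tilt U
    haveI := isAlgClosed_normedFieldTilt U
    haveI := charP_normedFieldTilt U
    (ofTilt U emb h b).SameValueGroup ∧ (ofTilt U emb h b).SameResidueField :=
  letI := normedFieldTilt U
  haveI := completeSpace_tilt U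
  haveI := isUltrametricDist_tilt U
  haveI := isAlgClosed_normedFieldTilt U
  haveI := charP_normedFieldTilt U
  ⟨sameValueGroup_ofTiltMonoidDatum U emb h _ (tiltMonoidDatum U) b,
    sameResidueField_of_isometry (ofTilt U emb h b) (RingEquiv.refl (tilt U)) fun _ => rfl⟩

end ArithHolStructure

/-! ## APPENDED (r1): Def. 4.1.1 INHABITED OUTRIGHT — the trivial Berkovich datum and the tilt base `ℂ_p♭` -/

/-- The TRIVIAL Berkovich datum over a tempered curve (every base-point type a point): p431050's `BerkovichDatum X` is an abstract
signature («no Berkovich spaces in Mathlib or the tree»), so it is inhabited content-free. Used only to exhibit a closed term of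
`ArithHolStructure`. [folklore] -/
def BerkovichDatum.trivial (X : Literature.AnabelianGeometry.SemiGraphs.TemperedCurve p) : BerkovichDatum X where
  BasePt _ _ := PUnit
  BasePtK _ _ := PUnit
  compose _ _ _ := PUnit.unit
  transport _ _ _ _ _ _ _ := PUnit.unit

namespace ArithHolStructure

open TiltModel

/-- **[J-I] Def. 4.1.1 INHABITED OUTRIGHT, for every tempered curve `X/E`**: the arithmetic holomorphic structure
`(X/E, (ℂ_p ⊃ E, ℂ_p♭ ≃ ℂ_p♭), ∗)` — untilt `K := ℂ_p` (E-t1's `Untilt.padicComplex`), `E = X.K ⊆ Q̄_p ↪ ℂ_p` (E-t1's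
`ATSObj.embPadicComplex`, continuous on `ℚ_p`), tilt base `F := ℂ_p♭ = ATS1.tilt (Untilt.padicComplex p)` with ALL FIVE instance slots
supplied by the hypothesis-free terms of this lineage (`normedFieldTilt`, `completeSpace_tilt`, `isUltrametricDist_tilt`,
`isAlgClosed_normedFieldTilt`, `charP_normedFieldTilt`), tilting datum `ι = id`, `♯` from `tiltMonoidDatum`, base point the point of the
trivial Berkovich datum. A CLOSED TERM: p431050 reading note (f) («NON-VACUITY … NOT constructible today … e.g. `ℂ_p♭`») is discharged
exactly at the example it named. CONSTRUCTED. [claim: Joshi2021ATS1, status: disputed] -/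
def ofPadicComplexTilt (X : Literature.AnabelianGeometry.SemiGraphs.TemperedCurve p) :
    letI := normedFieldTilt (Untilt.padicComplex p)
    haveI := completeSpace_tilt (Untilt.padicComplex p)
    haveI := isUltrametricDist_tilt (Untilt.padicComplex p)
    haveI := isAlgClosed_normedFieldTilt (Untilt.padicComplex p)
    haveI := charP_normedFieldTilt (Untilt.padicComplex p)
    ArithHolStructure X (BerkovichDatum.trivial X) (tilt (Untilt.padicComplex p)) :=
  ofTilt (A := BerkovichDatum.trivial X) (Untilt.padicComplex p) (ATSObj.embPadicComplex X) (ATSObj.continuous_embPadicComplex X)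
    PUnit.unit

/-- … so the type of arithmetic holomorphic structures on `X/E` over the tilt base `ℂ_p♭` (trivial Berkovich datum) is NONEMPTY, for
every `X`; together with `ofTilt_sameValueGroup_sameResidueField`, Prop. 4.1.7 (1)'s value-group and residue-field clauses hold for it
outright. [claim: Joshi2021ATS1, status: disputed] -/
theorem nonempty_padicComplexTilt (X : Literature.AnabelianGeometry.SemiGraphs.TemperedCurve p) :
    letI := normedFieldTilt (Untilt.padicComplex p)
    haveI := completeSpace_tilt (Untilt.padicComplex p)
    haveI := isUltrametricDist_tilt (Untilt.padicComplex p)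
    haveI := isAlgClosed_normedFieldTilt (Untilt.padicComplex p)
    haveI := charP_normedFieldTilt (Untilt.padicComplex p)
    Nonempty (ArithHolStructure X (BerkovichDatum.trivial X) (tilt (Untilt.padicComplex p))) ∧
      (ofPadicComplexTilt X).SameValueGroup ∧ (ofPadicComplexTilt X).SameResidueField :=
  ⟨⟨ofPadicComplexTilt X⟩, ofTilt_sameValueGroup_sameResidueField (A := BerkovichDatum.trivial X) (Untilt.padicComplex p)
    (ATSObj.embPadicComplex X) (ATSObj.continuous_embPadicComplex X) PUnit.unit⟩

end ArithHolStructure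

end Summit.ABC.IUTFork.Joshi.ATS1

end
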